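import Summits.QuantumFields.YangMills.Theorems.ConvexGribovBodyBrascampLiebVacuumSCCubeWitnessOfDimensionGap
import Mathlib.Analysis.Normed.Algebra.MatrixExponential
import Mathlib.Analysis.SpecialFunctions.Exponential
import Mathlib.MeasureTheory.Measure.Lebesgue.EqHaar

/-!
# Crux `BrascampLiebVacuumSC` (stmt-QuantumFields-16404), line `SketchIdeator1`, skeleton v7:
# stub `stub_euclidBalls` (Euclidean covering/packing of balls in subspaces of the matrix space)

Registered stub of skeleton v7 (lead c4, `prover-line-stmt-QuantumFields-16404-c4-0`). The Haar dimension
gap of a compact matrix group is derived in the skeleton from metric entropy; this file supplies the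
pure Euclidean ingredient: in a real subspace `W` of `M_N(ℂ)` with the Frobenius norm
(`froSq X = ‖X‖²_F`), for `0 < ε ≤ s` there is ONE finite set `T ⊆ W ∩ B_s` which is `ε`-separated,
an `ε`-net of `W ∩ B_s`, and has `Ccov⁻¹ ε^{-k} ≤ |T| ≤ Ccov ε^{-k}`, `k = dim_ℝ W`, with `Ccov`
depending on `(N, W, s)` only (`Ccov = (4s)^k + s^{-k}`).

Proof (volume argument, in an abstract finite-dimensional real normed space `E`, then `E = ↥W`):
with an additive Haar measure `μ` on `E`, `μ (B_r(x)) = r^k μ(B_1)` (`Measure.addHaar_ball_of_pos`).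
(a) An `ε`-separated `T ⊆ B_s` has `|T| (ε/2)^k ≤ (2s)^k`: the balls `B_{ε/2}(x)`, `x ∈ T`, are
disjoint inside `B_{2s}` (`EuclidBalls.card_mul_pow_le`). (b) Hence cardinalities of such `T` are
bounded and one of MAXIMAL cardinality exists (`Nat.sSup_mem`); maximality makes it an `ε`-net
(otherwise a far point could be added). (c) An `ε`-net `T` of `B_s` has `s^k ≤ |T| ε^k` since the
balls `B_ε(y)`, `y ∈ T`, cover `B_s` (`EuclidBalls.exists_net`). (d) Transport to matrices along
`Subtype.val : ↥W → M_N(ℂ)` and `froSq = ‖·‖²` (`SupMeasurable.froSq_eq_norm_sq`).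
Everything is proved; no named facts.
-/

set_option autoImplicit false

open scoped BigOperators Topology Matrix ENNReal
open Filter MeasureTheory
open Literature.MathematicalPhysics.QuantumFieldTheory
open Summit.QuantumFields.YangMills.Cruxes.CovarianceBound.SupportWindow (froSq)

noncomputable section

namespace Summit.QuantumFields.YangMills.Theorems.BrascampLiebVacuumSC

namespace EuclidBalls

section Generic

variable {E : Type*} [NormedAddCommGroup E] [NormedSpace ℝ E] [FiniteDimensional ℝ E]

/-- **Packing bound.** In a `k`-dimensional real normed space, a finite `ε`-separated subset `T` of the
open ball `B_s` (`0 < ε ≤ s`) has `|T| ε^k ≤ (4s)^k`: the balls `B_{ε/2}(x)`, `x ∈ T`, are pairwise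
disjoint and contained in `B_{2s}`, and `μ(B_r) = r^k μ(B_1)` for an additive Haar measure `μ`.
[folklore] -/
theorem card_mul_pow_le {s ε : ℝ} (hs : 0 < s) (hε : 0 < ε) (hεs : ε ≤ s) (T : Finset E)
    (hT : ∀ x ∈ T, ‖x‖ < s) (hsep : ∀ x ∈ T, ∀ y ∈ T, x ≠ y → ε ≤ ‖x - y‖) :
    (T.card : ℝ) * ε ^ Module.finrank ℝ E ≤ (4 * s) ^ Module.finrank ℝ E := by
  borelize E
  set k := Module.finrank ℝ E
  set μ : Measure E := (Module.finBasis ℝ E).addHaar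
  have hpos : 0 < μ (Metric.ball (0 : E) 1) := Metric.measure_ball_pos μ 0 one_pos
  have hlt : μ (Metric.ball (0 : E) 1) < ∞ := measure_ball_lt_top
  have hdisj : (↑T : Set E).PairwiseDisjoint (fun x => Metric.ball x (ε / 2)) := by
    intro x hx y hy hxy
    refine Metric.ball_disjoint_ball ?_
    rw [dist_eq_norm]
    linarith [hsep x hx y hy hxy]
  have hU : μ (⋃ x ∈ T, Metric.ball x (ε / 2)) = ∑ x ∈ T, μ (Metric.ball x (ε / 2)) :=
    measure_biUnion_finset hdisj fun x _ => measurableSet_ball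
  have hsub : (⋃ x ∈ T, Metric.ball x (ε / 2)) ⊆ Metric.ball (0 : E) (2 * s) := by
    intro z hz
    simp only [Set.mem_iUnion] at hz
    obtain ⟨x, hx, hz⟩ := hz
    rw [Metric.mem_ball, dist_eq_norm] at hz
    rw [mem_ball_zero_iff]
    calc ‖z‖ = ‖(z - x) + x‖ := by rw [sub_add_cancel]
      _ ≤ ‖z - x‖ + ‖x‖ := norm_add_le _ _
      _ < ε / 2 + s := add_lt_add hz (hT x hx)
      _ ≤ 2 * s := by linarith
  have hball : ∀ x : E, μ (Metric.ball x (ε / 2)) =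
      ENNReal.ofReal ((ε / 2) ^ k) * μ (Metric.ball 0 1) :=
    fun x => Measure.addHaar_ball_of_pos μ x (by positivity)
  have key : (T.card : ℝ≥0∞) * ENNReal.ofReal ((ε / 2) ^ k) * μ (Metric.ball 0 1) ≤
      ENNReal.ofReal ((2 * s) ^ k) * μ (Metric.ball 0 1) := by
    calc (T.card : ℝ≥0∞) * ENNReal.ofReal ((ε / 2) ^ k) * μ (Metric.ball 0 1)
        = ∑ x ∈ T, μ (Metric.ball x (ε / 2)) := by
          simp only [hball, Finset.sum_const, nsmul_eq_mul, mul_assoc]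
      _ = μ (⋃ x ∈ T, Metric.ball x (ε / 2)) := hU.symm
      _ ≤ μ (Metric.ball (0 : E) (2 * s)) := measure_mono hsub
      _ = ENNReal.ofReal ((2 * s) ^ k) * μ (Metric.ball 0 1) :=
          Measure.addHaar_ball_of_pos μ 0 (by positivity)
  rw [ENNReal.mul_le_mul_iff_left hpos.ne' hlt.ne, ← ENNReal.ofReal_natCast,
    ← ENNReal.ofReal_mul (by positivity), ENNReal.ofReal_le_ofReal_iff (by positivity)] at key
  calc (T.card : ℝ) * ε ^ k = (T.card : ℝ) * (ε / 2) ^ k * 2 ^ k := by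
        rw [mul_assoc, ← mul_pow, div_mul_cancel₀ ε two_ne_zero]
    _ ≤ (2 * s) ^ k * 2 ^ k := mul_le_mul_of_nonneg_right key (by positivity)
    _ = (4 * s) ^ k := by rw [← mul_pow]; ring

/-- **A maximal separated set is a net of the right size.** In a `k`-dimensional real normed space,
for `0 < ε ≤ s` there is a finite `T ⊆ B_s`, `ε`-separated, with `|T| ε^k ≤ (4s)^k`,
`s^k ≤ |T| ε^k`, which is an `ε`-net of `B_s` (an `ε`-separated subset of `B_s` of maximal
cardinality; the covering bound because the balls `B_ε(y)`, `y ∈ T`, cover `B_s`). [folklore] -/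
theorem exists_net {s ε : ℝ} (hs : 0 < s) (hε : 0 < ε) (hεs : ε ≤ s) :
    ∃ T : Finset E, (∀ x ∈ T, ‖x‖ < s) ∧
      (T.card : ℝ) * ε ^ Module.finrank ℝ E ≤ (4 * s) ^ Module.finrank ℝ E ∧
      s ^ Module.finrank ℝ E ≤ (T.card : ℝ) * ε ^ Module.finrank ℝ E ∧
      (∀ x : E, ‖x‖ < s → ∃ y ∈ T, ‖x - y‖ < ε) ∧
      (∀ x ∈ T, ∀ y ∈ T, x ≠ y → ε ≤ ‖x - y‖) := by
  classical
  set k := Module.finrank ℝ E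
  -- the achievable cardinalities of `ε`-separated subsets of `B_s`
  set S : Set ℕ := {n | ∃ T : Finset E, (∀ x ∈ T, ‖x‖ < s) ∧
    (∀ x ∈ T, ∀ y ∈ T, x ≠ y → ε ≤ ‖x - y‖) ∧ T.card = n} with hS_def
  have hS0 : (0 : ℕ) ∈ S := ⟨∅, by simp, by simp, rfl⟩
  have hbdd : BddAbove S := by
    refine ⟨⌈(4 * s) ^ k / ε ^ k⌉₊, ?_⟩
    rintro n ⟨T, hT, hsep, rfl⟩
    have h' : (T.card : ℝ) ≤ (4 * s) ^ k / ε ^ k := by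
      rw [le_div_iff₀ (by positivity)]
      exact card_mul_pow_le hs hε hεs T hT hsep
    exact_mod_cast h'.trans (Nat.le_ceil _)
  obtain ⟨T, hT, hsep, hcard⟩ := Nat.sSup_mem ⟨0, hS0⟩ hbdd
  have hmax : ∀ T' : Finset E, (∀ x ∈ T', ‖x‖ < s) →
      (∀ x ∈ T', ∀ y ∈ T', x ≠ y → ε ≤ ‖x - y‖) → T'.card ≤ T.card := by
    intro T' hT' hsep'
    rw [hcard]
    exact le_csSup hbdd ⟨T', hT', hsep', rfl⟩
  -- maximality: `T` is an `ε`-net of `B_s`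
  have hnet : ∀ x : E, ‖x‖ < s → ∃ y ∈ T, ‖x - y‖ < ε := by
    intro x hx
    by_contra h
    push Not at h
    have hxT : x ∉ T := by
      intro hxT
      have := h x hxT
      rw [sub_self, norm_zero] at this
      exact absurd this (not_le.mpr hε)
    have h1 := hmax (insert x T) ?_ ?_
    · rw [Finset.card_insert_of_notMem hxT] at h1
      omega
    · intro y hy
      rw [Finset.mem_insert] at hy
      rcases hy with rfl | hy
      · exact hx
      · exact hT y hy
    · intro y hy z hz hyz
      rw [Finset.mem_insert] at hy hz
      rcases hy with rfl | hy <;> rcases hz with rfl | hz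
      · exact absurd rfl hyz
      · exact h z hz
      · rw [norm_sub_rev]; exact h y hy
      · exact hsep y hy z hz hyz
  refine ⟨T, hT, card_mul_pow_le hs hε hεs T hT hsep, ?_, hnet, hsep⟩
  -- covering bound by volume
  borelize E
  set μ : Measure E := (Module.finBasis ℝ E).addHaar
  have hpos : 0 < μ (Metric.ball (0 : E) 1) := Metric.measure_ball_pos μ 0 one_pos
  have hlt : μ (Metric.ball (0 : E) 1) < ∞ := measure_ball_lt_top
  have hsub : Metric.ball (0 : E) s ⊆ ⋃ y ∈ T, Metric.ball y ε := by
    intro x hx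
    rw [mem_ball_zero_iff] at hx
    obtain ⟨y, hy, hxy⟩ := hnet x hx
    simp only [Set.mem_iUnion]
    exact ⟨y, hy, by rwa [Metric.mem_ball, dist_eq_norm]⟩
  have hball : ∀ y : E, μ (Metric.ball y ε) = ENNReal.ofReal (ε ^ k) * μ (Metric.ball 0 1) :=
    fun y => Measure.addHaar_ball_of_pos μ y hε
  have key : ENNReal.ofReal (s ^ k) * μ (Metric.ball 0 1) ≤
      (T.card : ℝ≥0∞) * ENNReal.ofReal (ε ^ k) * μ (Metric.ball 0 1) := by
    calc ENNReal.ofReal (s ^ k) * μ (Metric.ball 0 1) = μ (Metric.ball (0 : E) s) :=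
          (Measure.addHaar_ball_of_pos μ 0 hs).symm
      _ ≤ μ (⋃ y ∈ T, Metric.ball y ε) := measure_mono hsub
      _ ≤ ∑ y ∈ T, μ (Metric.ball y ε) := measure_biUnion_finset_le T _
      _ = (T.card : ℝ≥0∞) * ENNReal.ofReal (ε ^ k) * μ (Metric.ball 0 1) := by
          simp only [hball, Finset.sum_const, nsmul_eq_mul, mul_assoc]
  rw [ENNReal.mul_le_mul_iff_left hpos.ne' hlt.ne, ← ENNReal.ofReal_natCast,
    ← ENNReal.ofReal_mul (by positivity), ENNReal.ofReal_le_ofReal_iff (by positivity)] at key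
  exact key

end Generic

section Frobenius

open scoped Matrix.Norms.Frobenius

open Summit.QuantumFields.YangMills.Cruxes.CovarianceBound.SupportWindow.SupMeasurable
  (froSq_eq_norm_sq)

/-- **The stub in Frobenius-norm form, transported to matrices.** For a real subspace `W` of `M_N(ℂ)`
and `0 < s`, with `k = dim_ℝ W` and `Ccov = (4s)^k + s^{-k}`: for every `0 < ε ≤ s` some finite
`T ⊆ W ∩ {froSq < s²}` is `ε`-separated and an `ε`-net of `W ∩ {froSq < s²}` in `froSq = ‖·‖²_F`, with
`|T| ≤ Ccov / ε^k` and `1 ≤ Ccov ε^k |T|`. [folklore] -/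
theorem main (N : ℕ) (W : Submodule ℝ (Matrix (Fin N) (Fin N) ℂ)) (s : ℝ) (hs : 0 < s) :
    ∃ Ccov : ℝ, 0 < Ccov ∧ ∀ ε : ℝ, 0 < ε → ε ≤ s →
      ∃ T : Finset (Matrix (Fin N) (Fin N) ℂ),
        (↑T ⊆ (W : Set (Matrix (Fin N) (Fin N) ℂ)) ∩ {X | froSq X < s ^ 2}) ∧
        (T.card : ℝ) ≤ Ccov / ε ^ Module.finrank ℝ W ∧
        1 ≤ Ccov * ε ^ Module.finrank ℝ W * (T.card : ℝ) ∧
        (∀ X ∈ W, froSq X < s ^ 2 → ∃ Y ∈ T, froSq (X - Y) < ε ^ 2) ∧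
        (∀ X ∈ T, ∀ Y ∈ T, X ≠ Y → ε ^ 2 ≤ froSq (X - Y)) := by
  set k := Module.finrank ℝ W
  have hsk : 0 < s ^ k := pow_pos hs k
  refine ⟨(4 * s) ^ k + (s ^ k)⁻¹, by positivity, ?_⟩
  intro ε hε hεs
  obtain ⟨T, hT, hup, hlow, hnet, hsep⟩ := exists_net (E := W) hs hε hεs
  simp only [Submodule.coe_norm, Submodule.coe_sub] at hT hnet hsep
  have hεk : 0 < ε ^ k := pow_pos hε k
  -- norms versus `froSq`
  have hlt_iff : ∀ (Z : Matrix (Fin N) (Fin N) ℂ) (t : ℝ), 0 < t → (froSq Z < t ^ 2 ↔ ‖Z‖ < t) := by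
    intro Z t ht
    rw [froSq_eq_norm_sq]
    exact pow_lt_pow_iff_left₀ (norm_nonneg _) ht.le two_ne_zero
  have hle_iff : ∀ (Z : Matrix (Fin N) (Fin N) ℂ) (t : ℝ), 0 < t → (t ^ 2 ≤ froSq Z ↔ t ≤ ‖Z‖) := by
    intro Z t ht
    rw [froSq_eq_norm_sq]
    exact pow_le_pow_iff_left₀ ht.le (norm_nonneg _) two_ne_zero
  refine ⟨T.map (Function.Embedding.subtype _), ?_, ?_, ?_, ?_, ?_⟩
  · intro X hX
    rw [Finset.coe_map, Set.mem_image] at hX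
    obtain ⟨x, hx, rfl⟩ := hX
    exact ⟨x.2, (hlt_iff _ _ hs).2 (hT x hx)⟩
  · rw [Finset.card_map, le_div_iff₀ hεk]
    calc (T.card : ℝ) * ε ^ k ≤ (4 * s) ^ k := hup
      _ ≤ (4 * s) ^ k + (s ^ k)⁻¹ := le_add_of_nonneg_right (inv_nonneg.mpr hsk.le)
  · rw [Finset.card_map]
    calc (1 : ℝ) = (s ^ k)⁻¹ * s ^ k := (inv_mul_cancel₀ hsk.ne').symm
      _ ≤ ((4 * s) ^ k + (s ^ k)⁻¹) * ((T.card : ℝ) * ε ^ k) :=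
          mul_le_mul (le_add_of_nonneg_left (by positivity)) hlow hsk.le (by positivity)
      _ = ((4 * s) ^ k + (s ^ k)⁻¹) * ε ^ k * (T.card : ℝ) := by ring
  · intro X hXW hXs
    obtain ⟨y, hy, hxy⟩ := hnet ⟨X, hXW⟩ ((hlt_iff X s hs).1 hXs)
    exact ⟨(y : Matrix (Fin N) (Fin N) ℂ), Finset.mem_map.2 ⟨y, hy, rfl⟩, (hlt_iff _ _ hε).2 hxy⟩
  · intro X hX Y hY hXY
    rw [Finset.mem_map] at hX hY
    obtain ⟨x, hx, rfl⟩ := hX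
    obtain ⟨y, hy, rfl⟩ := hY
    have hxy : x ≠ y := fun h => hXY (by rw [h])
    rw [hle_iff _ _ hε]
    exact hsep x hx y hy hxy

end Frobenius

end EuclidBalls

/-- **Stub (PROVABLE — Euclidean covering/packing of balls in subspaces of the matrix space).** For a
real subspace `W` of `M_N(ℂ)` (Frobenius norm `‖X‖²_F = froSq X = Σ |X_ab|²`) and `0 < s` there is
`Ccov = Ccov(N, W, s) > 0` such that for every `0 < ε ≤ s` some finite `T ⊆ W ∩ B_s` is
`ε`-separated (`‖X − Y‖_F ≥ ε` for `X ≠ Y` in `T`), is an `ε`-net of `W ∩ B_s`, and has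
`Ccov⁻¹ ε^{−dim W} ≤ |T| ≤ Ccov ε^{−dim W}` — a maximal `ε`-separated subset of `W ∩ B_s`: the balls
`B_{ε/2}(Y)`, `Y ∈ T`, are disjoint inside `B_{2s}` (so `|T| ≤ (4s/ε)^{dim W}` by the scaling
`vol B_t = t^{dim W} vol B_1` of Lebesgue measure on `W`), and maximality makes the `B_ε(Y)` cover
`W ∩ B_s` (so `|T| ≥ (s/ε)^{dim W}`). [folklore] -/
theorem stub_euclidBalls :
    ∀ (N : ℕ) (W : Submodule ℝ (Matrix (Fin N) (Fin N) ℂ)) (s : ℝ), 0 < s →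
      ∃ Ccov : ℝ, 0 < Ccov ∧ ∀ ε : ℝ, 0 < ε → ε ≤ s →
        ∃ T : Finset (Matrix (Fin N) (Fin N) ℂ),
          (↑T ⊆ (W : Set (Matrix (Fin N) (Fin N) ℂ)) ∩ {X | froSq X < s ^ 2}) ∧
          (T.card : ℝ) ≤ Ccov / ε ^ Module.finrank ℝ W ∧
          1 ≤ Ccov * ε ^ Module.finrank ℝ W * (T.card : ℝ) ∧
          (∀ X ∈ W, froSq X < s ^ 2 → ∃ Y ∈ T, froSq (X - Y) < ε ^ 2) ∧
          (∀ X ∈ T, ∀ Y ∈ T, X ≠ Y → ε ^ 2 ≤ froSq (X - Y)) :=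
  EuclidBalls.main

end Summit.QuantumFields.YangMills.Theorems.BrascampLiebVacuumSC

end
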